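import Mathlib.Probability.Kernel.Basic
import Mathlib.MeasureTheory.Integral.Bochner.Basic
import Mathlib.MeasureTheory.Integral.Prod
import Mathlib.Analysis.SpecialFunctions.Log.Deriv
import Literature.Analysis.FunctionSpaces.TorusCalculus
import HarnessLib

/-!
# Dissipative measure-valued solutions of the complete compressible Euler system on `𝕋³`

Definition request `defn-DissipativeMVEulerSolution` (topic `FluidPDE`; consumers: the named fact
"Březina–Feireisl 2018, Thm 3.3 (weak (measure-valued)–strong uniqueness)" `wi-05002` and the crux
`stmt-AtomisticToContinuum-0825` for the hard-sphere equation of state).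

Březina–Feireisl (J. Math. Soc. Japan 70 (2018), arXiv:1702.04870), §2.2, **Definition 2.9**.
Phase space `F = {[ρ, E, m] : ρ ≥ 0, E ≥ 0, m ∈ ℝ³}` (density, *internal* energy density
`E = ρ e`, momentum). A dissipative measure-valued (DMV) solution on `(0, T) × Ω`,
`Ω = 𝕋³ = ([0,1]|_{0,1})³`, with initial datum `Y_{0,x}`, is a Young measure
`(t, x) ↦ Y_{t,x} ∈ L^∞_{w*}((0,T) × Ω; 𝒫(F))` and a dissipation defect `D ∈ L^∞(0, T)` with

* (2.25) `[∫_Ω ⟨Y_{t,x}; ρ⟩ φ dx]_{t=0}^{t=τ} = ∫₀^τ ∫_Ω ⟨Y; ρ⟩ ∂ₜφ + ⟨Y; m⟩ · ∇ₓφ`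
  for a.a. `τ ∈ (0,T)`, all `φ ∈ C¹([0,T] × Ω)`;
* (2.26) `[∫_Ω ⟨Y; m⟩ · φ dx]_{0}^{τ} = ∫₀^τ ∫_Ω ⟨Y; m⟩ · ∂ₜφ + ⟨Y; m ⊗ m/ρ⟩ : ∇ₓφ
  + ⟨Y; p(ρ, E)⟩ div φ + ∫₀^τ ∇ₓφ : dμ_R` for a.a. `τ`, all `φ ∈ C¹([0,T] × Ω; ℝ³)`, with a
  concentration measure `μ_R ∈ 𝓜([0,T] × Ω; ℝ^{3×3})`;
* (2.27) `[∫_Ω ⟨Y; ρ Z(s(ρ,E))⟩ φ dx]_{0}^{τ} ≥ ∫₀^τ ∫_Ω ⟨Y; ρ Z(s)⟩ ∂ₜφ + ⟨Y; Z(s) m⟩ · ∇ₓφ`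
  for a.a. `τ`, all `φ ∈ C¹, φ ≥ 0`, all `Z ∈ BC(ℝ)` non-decreasing;
* (2.28) `[∫_Ω ⟨Y; ½|m|²/ρ + E⟩ dx]_{0}^{τ} + D(τ) = 0` for a.a. `τ`;
* (2.29) `‖μ_R‖_{𝓜([0,τ) × Ω)} ≤ c ∫₀^τ D(t) dt` for a.a. `τ`.

Here `p = p(ρ, E)` and `s = s(ρ, E)` are the pressure and the specific entropy written in the
conservative variables (BF §2.2: any `G(ρ, ϑ, u)` "can be identified with a function of
`[ρ, E, m]`" through `ϑ = ϑ(ρ, E)`, thanks to thermodynamic stability (2.24)).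

## Formalisation choices

* `EulerPhase = ℝ × ℝ × ℝ³` with projections `dens`, `ien`, `mom`; the constraint `ρ, E ≥ 0` and
  the no-vacuum-momentum condition (2.20) `supp Y ∩ {ρ = 0, m ≠ 0} = ∅` (BF Remark 2.7, a
  consequence of (2.28) with the convention `|m|²/ρ = ∞`) are the field `support`; accordingly the
  kinetic energy `kineticEnergy w = |m|²/(2ρ)` carries the harmless junk value `0` at `ρ = 0`.
* The Young measure is a Markov kernel `Y : Kernel (ℝ × 𝕋³) EulerPhase` (weak-* measurability =
  measurability of the kernel); its slice `Y (0, ·)` **is** the initial datum `Y_{0,x}`.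
  `⟨Y_{t,x}; g⟩ = Young.avg Y g t x`.
* `L^∞(0,T; L¹(Ω))` control of `ρ, |m|, |m|²/ρ + E, |p|` (BF (2.8)–(2.11), Remark 2.6, and the
  standing requirement that all brackets in (2.25)–(2.28) be finite) is the field `moment_bound`,
  stated with lower Lebesgue integrals so that no Bochner integral below is a silent junk `0`.
* Test functions: `φ : ℝ → 𝕋³ → ℝ` (resp. `→ ℝ³`) with `C¹` space–time lift
  (`Torus.stLift`, `Torus.timeDeriv`, `Torus.gradient`, `Torus.divergence`, `Torus.partialDeriv` of
  `TorusCalculus.lean`); `C¹` on all of `ℝ × 𝕋³` is the same class as `C¹([0,T] × Ω)` restricted.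
* The matrix-valued signed measure `μ_R` is represented by its Jordan parts: two families of finite
  measures `μ⁺ μ⁻ : Fin 3 → Fin 3 → Measure (ℝ × 𝕋³)`,
  `∫ ∇φ : dμ_R = ∑ᵢⱼ (∫ ∂ⱼφᵢ dμ⁺ᵢⱼ - ∫ ∂ⱼφᵢ dμ⁻ᵢⱼ)`
  and `‖μ_R‖ ≤ ∑ᵢⱼ (μ⁺ᵢⱼ + μ⁻ᵢⱼ)`; since the constant `c` in (2.29) is existential and all norms
  on `ℝ^{3×3}` are equivalent, this is equivalent to (2.26) + (2.29).
* "for a.a. `τ ∈ (0,T)` and for any `φ`" is read as `∀ φ, ∀ᵐ τ ∈ (0,T)`.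
* Equations of state: `ConservativeEOS` = the two functions `p(ρ,E)`, `s(ρ,E)` the definition
  consumes; `EulerEOS` = `p, e, s` in the variables `(ρ, ϑ)` plus the temperature inversion
  `ϑ(ρ, E)`, with `EulerEOS.toConservative`, the Gibbs relation `EulerEOS.IsGibbs` and
  thermodynamic stability `EulerEOS.IsThermodynamicallyStable` (2.24) as predicates (hypotheses
  of Thm 3.3, not of Def. 2.9). Instances: `EulerEOS.perfectGas cᵥ` ((2.1)) and
  `EulerEOS.monatomicExcess χ f` (`p = ρϑ χ(ρ)`, `e = 3ϑ/2`, `s = 3/2 log ϑ - log ρ - f(ρ)`: the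
  hard-sphere law of `HardSphereEuler.lean` is `χ = hsCompressibility (· σ³)`,
  `f = hsExcessFreeEnergy (· σ³)`).

## References

* J. Březina, E. Feireisl, *Measure-valued solutions to the complete Euler system*, J. Math. Soc.
  Japan 70 (2018) 1227–1245, §2 (Def. 2.9), §3 (Thm 3.3). arXiv:1702.04870.
* P. Gwiazda, A. Świerczewska-Gwiazda, E. Wiedemann, *Weak-strong uniqueness for measure-valued
  solutions of some compressible fluid models*, Nonlinearity 28 (2015) 3873–3890 (isentropic case).
-/

noncomputable section

open MeasureTheory ProbabilityTheory Set
open scoped ENNReal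

namespace Literature.Analysis.FluidPDE

namespace CompressibleEuler

/-! ## Phase space and Young measures -/

/-- The phase space `F ⊂ ℝ × ℝ × ℝ³` of the conservative variables `[ρ, E, m]`
(density, internal energy density, momentum); the constraints `ρ, E ≥ 0` are imposed on the
support of the Young measure. [cite: BrezinaFeireisl2018, §2.1.2] -/
abbrev EulerPhase : Type := ℝ × ℝ × EuclideanSpace ℝ (Fin 3)

namespace EulerPhase

/-- The density coordinate `ρ`. [cite: BrezinaFeireisl2018, §2.1.2] -/
def dens (w : EulerPhase) : ℝ := w.1

/-- The internal-energy-density coordinate `E = ρ e`. [cite: BrezinaFeireisl2018, §2.1.2] -/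
def ien (w : EulerPhase) : ℝ := w.2.1

/-- The momentum coordinate `m = ρ u`. [cite: BrezinaFeireisl2018, §2.1.2] -/
def mom (w : EulerPhase) : EuclideanSpace ℝ (Fin 3) := w.2.2

/-- The kinetic energy density `½ |m|²/ρ`, with junk value `0` on the vacuum `ρ = 0` (where DMV
solutions carry no momentum, field `support`; BF Remark 2.5/2.7 use `0` if `m = 0`, `∞` if
`ρ = 0 ≠ m`). [cite: BrezinaFeireisl2018, Remark 2.5] -/
def kineticEnergy (w : EulerPhase) : ℝ := ‖mom w‖ ^ 2 / (2 * dens w)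

/-- The admissible states `ρ ≥ 0`, `E ≥ 0`, and `m = 0` on the vacuum.
[cite: BrezinaFeireisl2018, §2.1.2 and (2.20)] -/
def admissible : Set EulerPhase := {w | 0 ≤ dens w ∧ 0 ≤ ien w ∧ (dens w = 0 → mom w = 0)}

/-- `dens (ρ, E, m) = ρ`. [folklore] -/
@[simp] theorem dens_mk (ρ E : ℝ) (m : EuclideanSpace ℝ (Fin 3)) : dens (ρ, E, m) = ρ := rfl

/-- `ien (ρ, E, m) = E`. [folklore] -/
@[simp] theorem ien_mk (ρ E : ℝ) (m : EuclideanSpace ℝ (Fin 3)) : ien (ρ, E, m) = E := rfl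

/-- `mom (ρ, E, m) = m`. [folklore] -/
@[simp] theorem mom_mk (ρ E : ℝ) (m : EuclideanSpace ℝ (Fin 3)) : mom (ρ, E, m) = m := rfl

/-- The kinetic energy vanishes on the vacuum (junk convention). [folklore] -/
@[simp] theorem kineticEnergy_of_dens_eq_zero {w : EulerPhase} (h : dens w = 0) :
    kineticEnergy w = 0 := by simp [kineticEnergy, h]

/-- The kinetic energy is non-negative on `ρ ≥ 0`. [folklore] -/
theorem kineticEnergy_nonneg {w : EulerPhase} (h : 0 ≤ dens w) : 0 ≤ kineticEnergy w := by
  unfold kineticEnergy; positivity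

end EulerPhase

open EulerPhase

/-- The bracket `⟨Y_{t,x}; g⟩ = ∫ g dY_{t,x}` of a Young measure (a kernel from space–time to the
phase space) against an observable `g`. [cite: BrezinaFeireisl2018, (2.12)] -/
def Young.avg (Y : Kernel (ℝ × UnitAddTorus (Fin 3)) EulerPhase) (g : EulerPhase → ℝ) (t : ℝ)
    (x : UnitAddTorus (Fin 3)) : ℝ :=
  ∫ w, g w ∂(Y (t, x))

/-- Vector-valued bracket `⟨Y_{t,x}; m⟩`-type averages. [cite: BrezinaFeireisl2018, (2.12)] -/
def Young.vavg (Y : Kernel (ℝ × UnitAddTorus (Fin 3)) EulerPhase)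
    (g : EulerPhase → EuclideanSpace ℝ (Fin 3)) (t : ℝ) (x : UnitAddTorus (Fin 3)) :
    EuclideanSpace ℝ (Fin 3) :=
  ∫ w, g w ∂(Y (t, x))

/-! ## Equations of state -/

/-- The two constitutive functions a DMV solution consumes, in the conservative variables:
pressure `p(ρ, E)` and specific entropy `s(ρ, E)` (BF §2.2: functions of `(ρ, ϑ)` are identified
with functions of `[ρ, E, m]` via `ϑ = ϑ(ρ, E)`). Values at `ρ = 0` or `E = 0` are conventions of
the instance. [cite: BrezinaFeireisl2018, §2.2] -/
structure ConservativeEOS where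
  /-- pressure as a function of density and internal energy density -/
  pressure : ℝ → ℝ → ℝ
  /-- specific entropy as a function of density and internal energy density -/
  entropy : ℝ → ℝ → ℝ

/-- A complete equation of state in the thermal variables `(ρ, ϑ)`: pressure `p`, specific
internal energy `e`, specific entropy `s`, together with the temperature `ϑ(ρ, E)` inverting
`E = ρ e(ρ, ϑ)` on `ρ, ϑ > 0` (well defined under thermodynamic stability `∂_ϑ e > 0`).
[cite: BrezinaFeireisl2018, (1.5), (2.24)] -/
structure EulerEOS where
  /-- pressure `p(ρ, ϑ)` -/
  p : ℝ → ℝ → ℝ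
  /-- specific internal energy `e(ρ, ϑ)` -/
  e : ℝ → ℝ → ℝ
  /-- specific entropy `s(ρ, ϑ)` -/
  s : ℝ → ℝ → ℝ
  /-- temperature as a function of `(ρ, E)` -/
  temperature : ℝ → ℝ → ℝ
  /-- `ϑ(ρ, ρ e(ρ, ϑ)) = ϑ` for `ρ, ϑ > 0` -/
  temperature_energy : ∀ ρ ϑ : ℝ, 0 < ρ → 0 < ϑ → temperature ρ (ρ * e ρ ϑ) = ϑ

namespace EulerEOS

/-- The conservative form `p(ρ, E) = p(ρ, ϑ(ρ,E))`, `s(ρ, E) = s(ρ, ϑ(ρ,E))`.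
[cite: BrezinaFeireisl2018, §2.2] -/
def toConservative (eos : EulerEOS) : ConservativeEOS where
  pressure ρ E := eos.p ρ (eos.temperature ρ E)
  entropy ρ E := eos.s ρ (eos.temperature ρ E)

/-- **Gibbs' relation** `ϑ Ds = De + p D(1/ρ)` on `ρ, ϑ > 0`, componentwise:
`ϑ ∂_ϑ s = ∂_ϑ e` and `ϑ ∂_ρ s = ∂_ρ e - p/ρ²`, for `C¹` constitutive functions.
[cite: BrezinaFeireisl2018, (1.5)] -/
def IsGibbs (eos : EulerEOS) : Prop :=
  ContDiffOn ℝ 1 (Function.uncurry eos.p) (Ioi 0 ×ˢ Ioi 0) ∧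
  ContDiffOn ℝ 1 (Function.uncurry eos.e) (Ioi 0 ×ˢ Ioi 0) ∧
  ContDiffOn ℝ 1 (Function.uncurry eos.s) (Ioi 0 ×ˢ Ioi 0) ∧
  ∀ ρ ϑ : ℝ, 0 < ρ → 0 < ϑ →
    ϑ * deriv (fun θ => eos.s ρ θ) ϑ = deriv (fun θ => eos.e ρ θ) ϑ ∧
    ϑ * deriv (fun r => eos.s r ϑ) ρ = deriv (fun r => eos.e r ϑ) ρ - eos.p ρ ϑ / ρ ^ 2

/-- **Thermodynamic stability** (2.24): `∂_ρ p > 0` and `∂_ϑ e > 0` on `ρ, ϑ > 0`.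
[cite: BrezinaFeireisl2018, (2.24)] -/
def IsThermodynamicallyStable (eos : EulerEOS) : Prop :=
  ∀ ρ ϑ : ℝ, 0 < ρ → 0 < ϑ →
    0 < deriv (fun r => eos.p r ϑ) ρ ∧ 0 < deriv (fun θ => eos.e ρ θ) ϑ

/-- The **perfect gas** `p = ρϑ`, `e = c_v ϑ`, `s = log(ϑ^{c_v}/ρ)`, `ϑ(ρ,E) = E/(c_v ρ)`
(`0 < c_v`). [cite: BrezinaFeireisl2018, (2.1)] -/
def perfectGas (cv : ℝ) (hcv : 0 < cv) : EulerEOS where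
  p ρ ϑ := ρ * ϑ
  e _ ϑ := cv * ϑ
  s ρ ϑ := cv * Real.log ϑ - Real.log ρ
  temperature ρ E := E / (cv * ρ)
  temperature_energy ρ ϑ hρ _ := by field_simp

/-- A **monatomic gas with excess free energy**: `p = ρ ϑ χ(ρ)`, `e = 3ϑ/2`,
`s = 3/2 log ϑ - log ρ - f(ρ)`, `ϑ(ρ, E) = 2E/(3ρ)`; the hard-sphere law of `HardSphereEuler.lean`
is `χ ρ = hsCompressibility (ρσ³)`, `f ρ = hsExcessFreeEnergy (ρσ³)` (Gibbs holds iff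
`χ = 1 + ρ f'`, the virial relation defining `hsCompressibility`).
[cite: BrezinaFeireisl2018, §2.2] -/
def monatomicExcess (χ f : ℝ → ℝ) : EulerEOS where
  p ρ ϑ := ρ * ϑ * χ ρ
  e _ ϑ := 3 / 2 * ϑ
  s ρ ϑ := 3 / 2 * Real.log ϑ - Real.log ρ - f ρ
  temperature ρ E := 2 * E / (3 * ρ)
  temperature_energy ρ ϑ hρ _ := by field_simp

/-- The perfect gas is thermodynamically stable: `∂_ρ p = ϑ > 0`, `∂_ϑ e = c_v > 0`. [folklore] -/
theorem perfectGas_isThermodynamicallyStable {cv : ℝ} (hcv : 0 < cv) :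
    (perfectGas cv hcv).IsThermodynamicallyStable := by
  intro ρ ϑ _ hϑ
  simp only [perfectGas]
  constructor
  · have : deriv (fun r : ℝ => r * ϑ) ρ = ϑ := by
      simp
    rw [this]; exact hϑ
  · have : deriv (fun θ : ℝ => cv * θ) ϑ = cv := by
      simp
    rw [this]; exact hcv

/-- The perfect gas satisfies Gibbs' relation (pointwise part): `ϑ ∂_ϑ s = c_v = ∂_ϑ e` and
`ϑ ∂_ρ s = -ϑ/ρ = ∂_ρ e - p/ρ²`. [folklore] -/
theorem perfectGas_gibbs_pointwise {cv : ℝ} (hcv : 0 < cv) {ρ ϑ : ℝ} (hρ : 0 < ρ) (hϑ : 0 < ϑ) :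
    ϑ * deriv (fun θ => (perfectGas cv hcv).s ρ θ) ϑ = deriv (fun θ => (perfectGas cv hcv).e ρ θ) ϑ ∧
    ϑ * deriv (fun r => (perfectGas cv hcv).s r ϑ) ρ =
      deriv (fun r => (perfectGas cv hcv).e r ϑ) ρ - (perfectGas cv hcv).p ρ ϑ / ρ ^ 2 := by
  simp only [perfectGas]
  constructor
  · have h1 : deriv (fun θ : ℝ => cv * Real.log θ - Real.log ρ) ϑ = cv * ϑ⁻¹ := by
      simp
    have h2 : deriv (fun θ : ℝ => cv * θ) ϑ = cv := by
      simp
    rw [h1, h2]; field_simp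
  · have h1 : deriv (fun r : ℝ => cv * Real.log ϑ - Real.log r) ρ = -ρ⁻¹ := by
      simp
    have h2 : deriv (fun _ : ℝ => cv * ϑ) ρ = 0 := deriv_const ρ _
    rw [h1, h2]; field_simp; ring

/-- Conservative pressure of the perfect gas: `p = E / c_v` off the vacuum.
[cite: BrezinaFeireisl2018, §2.1.3 Step 3] -/
theorem perfectGas_pressure {cv : ℝ} (hcv : 0 < cv) {ρ : ℝ} (hρ : ρ ≠ 0) (E : ℝ) :
    (perfectGas cv hcv).toConservative.pressure ρ E = E / cv := by
  simp only [toConservative, perfectGas]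
  field_simp

/-- Conservative pressure of the monatomic gas: `p = (2/3) E χ(ρ)` off the vacuum. [folklore] -/
theorem monatomicExcess_pressure (χ f : ℝ → ℝ) {ρ : ℝ} (hρ : ρ ≠ 0) (E : ℝ) :
    (monatomicExcess χ f).toConservative.pressure ρ E = 2 / 3 * E * χ ρ := by
  simp only [toConservative, monatomicExcess]
  field_simp

end EulerEOS

/-! ## Test functions and the concentration measure -/

/-- Scalar `C¹` space–time test functions `φ ∈ C¹(ℝ × 𝕋³)` (restricting to `[0,T] × Ω` gives
BF's class `C¹([0,T] × Ω)`). [cite: BrezinaFeireisl2018, Def. 2.9] -/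
def IsTestFunction (φ : ℝ → UnitAddTorus (Fin 3) → ℝ) : Prop := ContDiff ℝ 1 (FunctionSpaces.Torus.stLift φ)

/-- Vector `C¹` space–time test functions `φ ∈ C¹(ℝ × 𝕋³; ℝ³)`.
[cite: BrezinaFeireisl2018, Def. 2.9] -/
def IsVectorTestFunction (φ : ℝ → UnitAddTorus (Fin 3) → EuclideanSpace ℝ (Fin 3)) : Prop :=
  ContDiff ℝ 1 (FunctionSpaces.Torus.stLift φ)

/-- The entropy cut-offs `Z ∈ BC(ℝ)`, `Z' ≥ 0`: bounded, continuous, non-decreasing.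
[cite: BrezinaFeireisl2018, (2.5), Def. 2.9] -/
def IsEntropyCutoff (Z : ℝ → ℝ) : Prop :=
  Continuous Z ∧ Monotone Z ∧ ∃ M : ℝ, ∀ r, |Z r| ≤ M

/-- A **matrix-valued concentration measure** `μ_R ∈ 𝓜(ℝ × 𝕋³; ℝ^{3×3})`, given by its positive
and negative parts (finite measures) entrywise. [cite: BrezinaFeireisl2018, (2.21), Def. 2.9] -/
structure ConcentrationMeasure where
  /-- positive parts `μ⁺ᵢⱼ` -/
  pos : Fin 3 → Fin 3 → Measure (ℝ × UnitAddTorus (Fin 3))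
  /-- negative parts `μ⁻ᵢⱼ` -/
  neg : Fin 3 → Fin 3 → Measure (ℝ × UnitAddTorus (Fin 3))
  pos_finite : ∀ i j, IsFiniteMeasure (pos i j)
  neg_finite : ∀ i j, IsFiniteMeasure (neg i j)

namespace ConcentrationMeasure

/-- `∫_{[0,τ) × Ω} ∇ₓφ : dμ_R = ∑ᵢⱼ ∫ ∂ⱼφᵢ d(μ⁺ᵢⱼ - μ⁻ᵢⱼ)`. [cite: BrezinaFeireisl2018, (2.26)] -/
def pairGrad (μ : ConcentrationMeasure) (τ : ℝ)
    (φ : ℝ → UnitAddTorus (Fin 3) → EuclideanSpace ℝ (Fin 3)) : ℝ :=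
  ∑ i, ∑ j,
    ((∫ z in Ico 0 τ ×ˢ univ, FunctionSpaces.Torus.partialDeriv j (fun y => φ z.1 y i) z.2 ∂(μ.pos i j)) -
      ∫ z in Ico 0 τ ×ˢ univ, FunctionSpaces.Torus.partialDeriv j (fun y => φ z.1 y i) z.2 ∂(μ.neg i j))

/-- (An upper bound for) the total variation `‖μ_R‖_{𝓜([0,τ) × Ω; ℝ^{3×3})}`:
`∑ᵢⱼ (μ⁺ᵢⱼ + μ⁻ᵢⱼ)([0,τ) × Ω)` (equal to the entrywise-`ℓ¹` total variation for Jordan parts).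
[cite: BrezinaFeireisl2018, (2.29)] -/
def massUpTo (μ : ConcentrationMeasure) (τ : ℝ) : ℝ≥0∞ :=
  ∑ i, ∑ j, (μ.pos i j (Ico 0 τ ×ˢ univ) + μ.neg i j (Ico 0 τ ×ˢ univ))

/-- The zero concentration measure (no concentrations, e.g. for weak solutions). [folklore] -/
def zero : ConcentrationMeasure where
  pos _ _ := 0
  neg _ _ := 0
  pos_finite _ _ := by infer_instance
  neg_finite _ _ := by infer_instance

/-- The zero concentration measure pairs to `0`. [folklore] -/
@[simp] theorem pairGrad_zero (τ : ℝ) (φ : ℝ → UnitAddTorus (Fin 3) → EuclideanSpace ℝ (Fin 3)) :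
    zero.pairGrad τ φ = 0 := by simp [pairGrad, zero]

/-- The zero concentration measure has mass `0`. [folklore] -/
@[simp] theorem massUpTo_zero (τ : ℝ) : zero.massUpTo τ = 0 := by simp [massUpTo, zero]

end ConcentrationMeasure

/-! ## Dissipative measure-valued solutions (BF Definition 2.9) -/

/-- **Dissipative measure-valued solution of the complete Euler system on `(0,T) × 𝕋³`**
(Březina–Feireisl, Def. 2.9) for the constitutive functions `eos = (p(ρ,E), s(ρ,E))`: a Young
measure `Y` (Markov kernel `ℝ × 𝕋³ → 𝒫(F)`, initial datum = the slice `Y (0, ·)`) and a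
dissipation defect `D`, such that `Y` is carried by `F` with no momentum on the vacuum, `D ≥ 0` is
essentially bounded ((2.19): "non-negative `D ∈ L^∞(0,T)`"), the moments entering the equations are `L^∞(0,T; L¹)`, and the continuity
equation (2.25), the momentum equation with a concentration measure `μ_R` (2.26) dominated by `D`
(2.29), the renormalised entropy inequality (2.27) and the total energy balance with defect (2.28)
hold for a.a. `τ ∈ (0, T)`. [cite: BrezinaFeireisl2018, Definition 2.9] -/
structure IsDissipativeMVSolution (eos : ConservativeEOS) (T : ℝ)
    (Y : Kernel (ℝ × UnitAddTorus (Fin 3)) EulerPhase) (D : ℝ → ℝ) : Prop where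
  /-- `Y_{t,x}` is a probability measure -/
  markov : IsMarkovKernel Y
  /-- `Y_{t,x}` is carried by `F = {ρ ≥ 0, E ≥ 0}` and charges the vacuum only at `m = 0` (2.20) -/
  support : ∀ z, ∀ᵐ w ∂(Y z), w ∈ admissible
  /-- `D ∈ L^∞(0,T)`, `D ≥ 0` -/
  defect : AEStronglyMeasurable D (volume.restrict (Ioo 0 T)) ∧
    ∃ C : ℝ, ∀ᵐ τ ∂(volume.restrict (Ioo 0 T)), 0 ≤ D τ ∧ D τ ≤ C
  /-- `ρ, |m|, ½|m|²/ρ + E, |p(ρ,E)| ∈ L^∞(0,T; L¹(Ω; L¹(Y_{t,x})))` -/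
  moment_bound : ∃ C : ℝ≥0∞, C < ∞ ∧ ∀ᵐ τ ∂(volume.restrict (Ioo 0 T)),
    ∫⁻ x, ∫⁻ w, ENNReal.ofReal (dens w + ‖mom w‖ + kineticEnergy w + ien w +
      |eos.pressure (dens w) (ien w)|) ∂(Y (τ, x)) ≤ C
  /-- (2.25) continuity equation -/
  continuity : ∀ φ : ℝ → UnitAddTorus (Fin 3) → ℝ, IsTestFunction φ →
    ∀ᵐ τ ∂(volume.restrict (Ioo 0 T)),
    (∫ x, Young.avg Y dens τ x * φ τ x) - ∫ x, Young.avg Y dens 0 x * φ 0 x =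
      ∫ z in Ioo 0 τ ×ˢ univ, (Young.avg Y dens z.1 z.2 * FunctionSpaces.Torus.timeDeriv φ z.1 z.2 +
        inner ℝ (Young.vavg Y mom z.1 z.2) (FunctionSpaces.Torus.gradient (φ z.1) z.2))
  /-- (2.26) momentum equation with concentration measure `μ_R`, (2.29) `‖μ_R‖ ≤ c ∫₀^τ D` -/
  momentum : ∃ (μR : ConcentrationMeasure) (c : ℝ),
    (∀ φ : ℝ → UnitAddTorus (Fin 3) → EuclideanSpace ℝ (Fin 3), IsVectorTestFunction φ →
      ∀ᵐ τ ∂(volume.restrict (Ioo 0 T)),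
      (∫ x, inner ℝ (Young.vavg Y mom τ x) (φ τ x)) - ∫ x, inner ℝ (Young.vavg Y mom 0 x) (φ 0 x) =
        (∫ z in Ioo 0 τ ×ˢ univ, (inner ℝ (Young.vavg Y mom z.1 z.2) (FunctionSpaces.Torus.timeDeriv φ z.1 z.2) +
          (∑ i, ∑ j, Young.avg Y (fun w => mom w i * mom w j / dens w) z.1 z.2 *
            FunctionSpaces.Torus.partialDeriv j (fun y => φ z.1 y i) z.2) +
          Young.avg Y (fun w => eos.pressure (dens w) (ien w)) z.1 z.2 *
            FunctionSpaces.Torus.divergence (φ z.1) z.2)) +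
        μR.pairGrad τ φ) ∧
    (∀ᵐ τ ∂(volume.restrict (Ioo 0 T)),
      μR.massUpTo τ ≤ ENNReal.ofReal (c * ∫ t in Ioo 0 τ, D t))
  /-- (2.27) renormalised entropy inequality -/
  entropy : ∀ φ : ℝ → UnitAddTorus (Fin 3) → ℝ, IsTestFunction φ → (∀ t ∈ Icc 0 T, ∀ x, 0 ≤ φ t x) →
    ∀ Z : ℝ → ℝ, IsEntropyCutoff Z → ∀ᵐ τ ∂(volume.restrict (Ioo 0 T)),
    ∫ z in Ioo 0 τ ×ˢ univ,
      (Young.avg Y (fun w => dens w * Z (eos.entropy (dens w) (ien w))) z.1 z.2 *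
          FunctionSpaces.Torus.timeDeriv φ z.1 z.2 +
        inner ℝ (Young.vavg Y (fun w => Z (eos.entropy (dens w) (ien w)) • mom w) z.1 z.2)
          (FunctionSpaces.Torus.gradient (φ z.1) z.2)) ≤
    (∫ x, Young.avg Y (fun w => dens w * Z (eos.entropy (dens w) (ien w))) τ x * φ τ x) -
      ∫ x, Young.avg Y (fun w => dens w * Z (eos.entropy (dens w) (ien w))) 0 x * φ 0 x
  /-- (2.28) total energy balance with dissipation defect -/
  energy : ∀ᵐ τ ∂(volume.restrict (Ioo 0 T)),
    (∫ x, Young.avg Y (fun w => kineticEnergy w + ien w) τ x) + D τ =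
      ∫ x, Young.avg Y (fun w => kineticEnergy w + ien w) 0 x

end CompressibleEuler

end Literature.Analysis.FluidPDE
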